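import Summits.Ventures.CertifiedArithmetic.LowPrec.EnvelopesE2M1

/-!
# Exhaustive error envelopes of FP6 `E2M3` products and sums under RNE

HONEST FRAMING (venture CertifiedArithmetic / cell `pub-lowprec`): certified error envelopes and
provably optimal rounding/accumulation schemes for low-precision formats under stated cost models;
every table by two implementations; no hardware or vendor claims.

OCP MX FP6 `E2M3` (3 mantissa bits, bias 1, max 15/2). Same vocabulary and method as `EnvelopesE2M1.lean` (`envTest`, `relTest`, `countPairs`;
every statement closed by `decide +kernel` over all `64²` ordered pairs; implementation A is the
cell's independent enumerator).
-/

namespace Summit.Ventures.CertifiedArithmetic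

open Literature.ComputerArithmetic.FloatingPoint
open Literature.ComputerArithmetic.FloatingPoint.MiniFloat
open Literature.ComputerArithmetic.FloatingPoint.Format

/-! ### FP6 `E2M3` (64 data, 4096 ordered pairs) -/

/-- `E2M3` PRODUCTS, absolute envelope: for `|ab| ≤ 15/2`, `|fl(ab) - ab| ≤ [1/16, 1/16, 1/8, 1/4][E]`
(half the spacing of the result binade). -/
theorem E2M3_mul_abs_envelope (a b : MiniFloat E2M3) (h : |a.toRat * b.toRat| ≤ E2M3.maxRat) :
    |errMul E2M3 a b| ≤ [1/16, 1/16, 1/8, 1/4].getD (roundNE E2M3 (a.toRat * b.toRat)).expCode 0 := by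
  have := forall₂_of_all_all (P := envTest E2M3 (· * ·) [1/16, 1/16, 1/8, 1/4])
    (by decide +kernel) a b
  exact of_decide_eq_true this h

/-- `E2M3` PRODUCTS, attained in the top binade: `3/4 · 7 = 21/4 ↦ 5`, error `1/4`. -/
theorem E2M3_mul_abs_envelope_attained :
    ∃ a b : MiniFloat E2M3, |a.toRat * b.toRat| ≤ E2M3.maxRat ∧ |errMul E2M3 a b| = 1 / 4 :=
  ⟨⟨false, 0, 6, by decide, by decide, by decide⟩, ⟨false, 3, 6, by decide, by decide, by decide⟩,
    by decide +kernel⟩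

/-- `E2M3` PRODUCTS, relative envelope in range: constant `1` (ties to zero below the quantum);
on results in the normal range the largest relative error of a product is `7/135 < 1/17`. -/
theorem E2M3_mul_rel_envelope (a b : MiniFloat E2M3) (h : |a.toRat * b.toRat| ≤ E2M3.maxRat)
    (h0 : a.toRat * b.toRat ≠ 0) : |errMul E2M3 a b| ≤ 1 * |a.toRat * b.toRat| := by
  have := forall₂_of_all_all (P := relTest E2M3 (· * ·) 1) (by decide +kernel) a b
  exact of_decide_eq_true this h h0

/-- `E2M3` SUMS, absolute envelope: `[0, 0, 1/8, 1/4][E]` — sums landing below `2` are exact. -/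
theorem E2M3_add_abs_envelope (a b : MiniFloat E2M3) (h : |a.toRat + b.toRat| ≤ E2M3.maxRat) :
    |errAdd E2M3 a b| ≤ [0, 0, 1/8, 1/4].getD (roundNE E2M3 (a.toRat + b.toRat)).expCode 0 := by
  have := forall₂_of_all_all (P := envTest E2M3 (· + ·) [0, 0, 1/8, 1/4]) (by decide +kernel) a b
  exact of_decide_eq_true this h

/-- `E2M3` SUMS, attained: `1/4 + 4 = 17/4 ↦ 4`, error `1/4`. -/
theorem E2M3_add_abs_envelope_attained :
    ∃ a b : MiniFloat E2M3, |a.toRat + b.toRat| ≤ E2M3.maxRat ∧ |errAdd E2M3 a b| = 1 / 4 :=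
  ⟨⟨false, 0, 2, by decide, by decide, by decide⟩, ⟨false, 3, 0, by decide, by decide, by decide⟩,
    by decide +kernel⟩

/-- `E2M3` SUMS, relative envelope: `|fl(a+b) - (a+b)| ≤ |a+b| / 17`, the sharp constant `u/(1+u)`
with `u = 1/16`; attained at `1/4 + 4 = 17/4 ↦ 4`. -/
theorem E2M3_add_rel_envelope (a b : MiniFloat E2M3) (h : |a.toRat + b.toRat| ≤ E2M3.maxRat)
    (h0 : a.toRat + b.toRat ≠ 0) : |errAdd E2M3 a b| ≤ 1 / 17 * |a.toRat + b.toRat| := by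
  have := forall₂_of_all_all (P := relTest E2M3 (· + ·) (1 / 17)) (by decide +kernel) a b
  exact of_decide_eq_true this h h0

/-- `E2M3` COUNTS: of the 4096 ordered pairs, 1196 products and 2384 sums are exact; 1188 products
and 464 sums overflow (`|a ∘ b| > 15/2`). -/
theorem E2M3_counts :
    countPairs E2M3 (fun a b => decide (errMul E2M3 a b = 0)) = 1196 ∧
    countPairs E2M3 (fun a b => decide (errAdd E2M3 a b = 0)) = 2384 ∧
    countPairs E2M3 (fun a b => decide (E2M3.maxRat < |a.toRat * b.toRat|)) = 1188 ∧
    countPairs E2M3 (fun a b => decide (E2M3.maxRat < |a.toRat + b.toRat|)) = 464 := by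
  decide +kernel

end Summit.Ventures.CertifiedArithmetic
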